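import Summits.Ventures.DiscreteObjects.PP12.OrderElevenCollineation

/-!
# PP(12), order-11 cell, Case B (`NoTriangleData12`): the PACKED ENCODINGS of triangle data and their bit semantics (designs g23)
Framing: lottery ticket; floor = certified bounds/negative ranges.

Cell pub-namedobj (venture DiscreteObjects), target (M). The kernel certificate (`OrderElevenTriangleKernel`) computes on packed naturals; this file defines
the packing of actual data `D : TriangleData 11` and proves what each bit / digit means:

* `maskOf f c` — the mask of a Boolean predicate on `0 … c-1` (`testBit_maskOf`); `memN D s t x` — `D.mem` on natural indices (false out of range);
  `maskE D s t` — the 11-bit mask of the block `E_{s,t}`;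
* `aword D s = Σ_t maskE D s t <<< 22 t` (`testBit_aword`: bit `p` is `memN D s (p / 22) (p % 22)` for `p % 22 < 11`, `p / 22 < 11`, else `false`);
* `rowCode D s = (aword D s <<< 8) ||| (g₁ <<< 4) ||| g₂` and its digits (`rowCode_and_15`, `rowCode_shiftRight_four_and_15`, `rowCode_shiftRight_eight`);
* `packPhi φ = Σ_t φ t · 16^t` (as shifted `|||`) and its digits (`packPhi_digit`).

Imports only `OrderElevenCollineation` (round 0 of the landing DAG). Proofs only; nothing here asserts a census statement. No `sorry`, no new axioms.
-/

namespace Summit.Ventures.DiscreteObjects.PP12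

namespace Triangle12

/-! ### masks of Boolean predicates -/

/-- the mask with bit `x` set iff `x < c` and `f x` -/
def maskOf (f : ℕ → Bool) : ℕ → ℕ
  | 0 => 0
  | c + 1 => maskOf f c ||| (if f c then 1 <<< c else 0)

/-- bit semantics of `maskOf` -/
theorem testBit_maskOf (f : ℕ → Bool) (c i : ℕ) : (maskOf f c).testBit i = (decide (i < c) && f i) := by
  induction c with
  | zero => simp [maskOf]
  | succ c ih =>
    simp only [maskOf, Nat.testBit_or, ih]
    by_cases hfc : f c
    · simp only [hfc, if_true, Nat.testBit_shiftLeft]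
      by_cases hic : i = c
      · subst hic; simp [hfc]
      · have : (decide (i ≥ c) && Nat.testBit 1 (i - c)) = false := by
          by_cases hge : i ≥ c
          · have h1 : Nat.testBit 1 (i - c) = false := by
              rw [show (1 : ℕ) = 2 ^ 0 from rfl, Nat.testBit_two_pow]; simp; omega
            simp [hge, h1]
          · simp [hge]
        rw [this, Bool.or_false]
        by_cases hlt : i < c
        · simp [hlt, show i < c + 1 by omega]
        · have : ¬ i < c + 1 := by omega
          simp [hlt, this]
    · simp only [hfc]
      by_cases hic : i = c
      · subst hic; simp [hfc]
      · by_cases hlt : i < c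
        · simp [hlt, show i < c + 1 by omega]
        · have : ¬ i < c + 1 := by omega
          simp [hlt, this]

/-- a mask over `c ≤ 11` predicates is `< 2^11` -/
theorem maskOf_lt (f : ℕ → Bool) {c : ℕ} (hc : c ≤ 11) : maskOf f c < 2 ^ 11 := by
  apply Nat.lt_pow_two_of_testBit
  intro i hi
  rw [testBit_maskOf]
  have : ¬ i < c := by omega
  simp [this]

variable (D : TriangleData 11) (s : Fin 11)

/-- `D.mem` on natural indices (`false` out of range) -/
def memN (t x : ℕ) : Bool :=
  if ht : t < 11 then (if hx : x < 11 then D.mem s ⟨t, ht⟩ ⟨x, hx⟩ else false) else false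

/-- `memN` on genuine indices -/
theorem memN_val (t x : Fin 11) : memN D s t.val x.val = D.mem s t x := by
  simp [memN, t.isLt, x.isLt]

/-- `memN` is `false` when `x ≥ 11` -/
theorem memN_of_ge {t x : ℕ} (hx : 11 ≤ x) : memN D s t x = false := by
  unfold memN; split_ifs <;> first | rfl | omega

/-- `memN` is `false` when `t ≥ 11` -/
theorem memN_of_ge_left {t x : ℕ} (ht : 11 ≤ t) : memN D s t x = false := by
  unfold memN; split_ifs <;> first | rfl | omega

/-- the 11-bit mask of the block `E_{s,t}` -/
def maskE (t : ℕ) : ℕ := maskOf (memN D s t) 11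

/-- bit semantics of `maskE` -/
theorem testBit_maskE (t i : ℕ) : (maskE D s t).testBit i = memN D s t i := by
  rw [maskE, testBit_maskOf]
  by_cases hi : i < 11
  · simp [hi]
  · simp [hi, memN_of_ge D s (not_lt.1 hi)]

/-- `maskE < 2^11` -/
theorem maskE_lt (t : ℕ) : maskE D s t < 2 ^ 11 := maskOf_lt _ le_rfl

/-! ### the block word -/

/-- partial block word over the labels `t < c` -/
def awgo : ℕ → ℕ
  | 0 => 0
  | c + 1 => awgo c ||| (maskE D s c <<< (22 * c))

/-- **the block word** `A = Σ_t mask(E_{s,t}) <<< 22 t` -/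
def aword : ℕ := awgo D s 11

/-- bit semantics of the partial block word -/
theorem testBit_awgo (c p : ℕ) :
    (awgo D s c).testBit p = (decide (p / 22 < c) && decide (p % 22 < 11) && memN D s (p / 22) (p % 22)) := by
  induction c with
  | zero => simp [awgo]
  | succ c ih =>
    simp only [awgo, Nat.testBit_or, ih, Nat.testBit_shiftLeft, testBit_maskE]
    by_cases h1 : p / 22 < c
    · -- the old part is decisive; the new block sits higher
      have hlt : p / 22 < c + 1 := by omega
      have hng : ¬ (p ≥ 22 * c) := by omega
      simp [h1, hlt, hng]
    · by_cases h2 : p / 22 = c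
      · have hge : p ≥ 22 * c := by omega
        have hsub : p - 22 * c = p % 22 := by omega
        have hlt : p / 22 < c + 1 := by omega
        simp only [h2, hge, hsub, decide_true, Bool.true_and]
        by_cases h3 : p % 22 < 11
        · simp [h3]
        · simp [h3, memN_of_ge D s (not_lt.1 h3)]
      · have hlt : ¬ p / 22 < c + 1 := by omega
        simp only [h1, hlt, decide_false, Bool.false_and, Bool.false_or]
        by_cases hge : p ≥ 22 * c
        · have : 11 ≤ p - 22 * c := by omega
          simp [hge, memN_of_ge D s this]
        · simp [hge]

/-- **bit semantics of the block word**: bit `22 t + e` (`e < 11`, `t < 11`) is `D.mem s t e`; all other bits are `0` -/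
theorem testBit_aword (p : ℕ) :
    (aword D s).testBit p = (decide (p / 22 < 11) && decide (p % 22 < 11) && memN D s (p / 22) (p % 22)) :=
  testBit_awgo D s 11 p

/-- the block word at a genuine position -/
theorem testBit_aword_pos (t e : ℕ) (ht : t < 11) (he : e < 11) : (aword D s).testBit (22 * t + e) = memN D s t e := by
  rw [testBit_aword]
  have h1 : (22 * t + e) / 22 = t := by omega
  have h2 : (22 * t + e) % 22 = e := by omega
  simp [h1, h2, ht, he]

/-! ### the row code and its digits -/

/-- **the packed row** `(A <<< 8) ||| (g₁ <<< 4) ||| g₂` of the free line orbit `s` -/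
def rowCode : ℕ := (aword D s <<< 8) ||| ((D.g1 s).val <<< 4) ||| (D.g2 s).val

/-- a value `< 11` has no bits `≥ 4` -/
theorem testBit_val_high (x : Fin 11) {i : ℕ} (hi : 4 ≤ i) : x.val.testBit i = false := by
  have h16 : 16 ≤ 2 ^ i := calc (16 : ℕ) = 2 ^ 4 := by norm_num
    _ ≤ 2 ^ i := Nat.pow_le_pow_right (by norm_num) hi
  exact Nat.testBit_lt_two_pow (lt_of_lt_of_le (by omega : x.val < 16) h16)

/-- `15 = 2^4 − 1` bit pattern -/
theorem testBit_fifteen (i : ℕ) : Nat.testBit 15 i = decide (i < 4) := by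
  rw [show (15 : ℕ) = 2 ^ 4 - 1 by norm_num, Nat.testBit_two_pow_sub_one]

/-- digit `g₂` -/
theorem rowCode_and_15 : rowCode D s &&& 15 = (D.g2 s).val := by
  apply Nat.eq_of_testBit_eq; intro i
  simp only [rowCode, Nat.testBit_and, Nat.testBit_or, Nat.testBit_shiftLeft, testBit_fifteen]
  by_cases hi : i < 4
  · have h8 : ¬ (i ≥ 8) := by omega
    have h4 : ¬ (i ≥ 4) := by omega
    simp [hi, h8, h4]
  · simp [hi, testBit_val_high (D.g2 s) (not_lt.1 hi)]

/-- digit `g₁` -/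
theorem rowCode_shiftRight_four_and_15 : (rowCode D s >>> 4) &&& 15 = (D.g1 s).val := by
  apply Nat.eq_of_testBit_eq; intro i
  simp only [rowCode, Nat.testBit_and, Nat.testBit_shiftRight, Nat.testBit_or, Nat.testBit_shiftLeft, testBit_fifteen]
  have e4 : 4 + i - 4 = i := by omega
  by_cases hi : i < 4
  · have h8 : ¬ (4 + i ≥ 8) := by omega
    simp [hi, h8, e4, testBit_val_high (D.g2 s) (show 4 ≤ 4 + i by omega)]
  · simp [hi, testBit_val_high (D.g1 s) (not_lt.1 hi)]

/-- the block word back from the row code -/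
theorem rowCode_shiftRight_eight : rowCode D s >>> 8 = aword D s := by
  apply Nat.eq_of_testBit_eq; intro i
  simp only [rowCode, Nat.testBit_shiftRight, Nat.testBit_or, Nat.testBit_shiftLeft]
  have e8 : 8 + i - 8 = i := by omega
  simp [e8, testBit_val_high (D.g1 s) (show 4 ≤ 8 + i - 4 by omega), testBit_val_high (D.g2 s) (show 4 ≤ 8 + i by omega)]

/-! ### the packed third-pencil map -/

/-- partial packing of `φ` over `t < c` -/
def pkgo (φ : Fin 11 → Fin 11) : ℕ → ℕ
  | 0 => 0
  | c + 1 => pkgo φ c ||| ((if h : c < 11 then (φ ⟨c, h⟩).val else 0) <<< (4 * c))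

/-- **the packed map** `Σ_t φ t · 16^t` -/
def packPhi (φ : Fin 11 → Fin 11) : ℕ := pkgo φ 11

/-- bit semantics of the partial packing -/
theorem testBit_pkgo (φ : Fin 11 → Fin 11) (c p : ℕ) :
    (pkgo φ c).testBit p = (decide (p / 4 < c) && (if h : p / 4 < 11 then (φ ⟨p / 4, h⟩).val.testBit (p % 4) else false)) := by
  induction c with
  | zero => simp [pkgo]
  | succ c ih =>
    simp only [pkgo, Nat.testBit_or, ih, Nat.testBit_shiftLeft]
    by_cases h1 : p / 4 < c
    · have hlt : p / 4 < c + 1 := by omega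
      have hng : ¬ (p ≥ 4 * c) := by omega
      simp [h1, hlt, hng]
    · by_cases h2 : p / 4 = c
      · have hge : p ≥ 4 * c := by omega
        have hsub : p - 4 * c = p % 4 := by omega
        have hlt : p / 4 < c + 1 := by omega
        by_cases hc : c < 11
        · simp [h2, hge, hsub, hc]
        · simp [h2, hge, hsub, hc]
      · have hlt : ¬ p / 4 < c + 1 := by omega
        simp only [h1, hlt, decide_false, Bool.false_and, Bool.false_or]
        by_cases hge : p ≥ 4 * c
        · by_cases hc : c < 11
          · have : 4 ≤ p - 4 * c := by omega
            simp [hge, hc, testBit_val_high _ this]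
          · simp [hge, hc]
        · simp [hge]

/-- **digit semantics of the packed map**: `(packPhi φ >>> 4 t) &&& 15 = φ t` -/
theorem packPhi_digit (φ : Fin 11 → Fin 11) (t : Fin 11) : (packPhi φ >>> (4 * t.val)) &&& 15 = (φ t).val := by
  apply Nat.eq_of_testBit_eq; intro i
  simp only [packPhi, Nat.testBit_and, Nat.testBit_shiftRight, testBit_pkgo, testBit_fifteen]
  by_cases hi : i < 4
  · have h1 : (4 * t.val + i) / 4 = t.val := by omega
    have h2 : (4 * t.val + i) % 4 = i := by omega
    simp [hi, h1, h2, t.isLt]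
  · simp [hi, testBit_val_high (φ t) (not_lt.1 hi)]

/-- all digits `t ≥ 11` of the packed map vanish: `packPhi φ < 2^44` -/
theorem packPhi_lt (φ : Fin 11 → Fin 11) : packPhi φ < 2 ^ 44 := by
  apply Nat.lt_pow_two_of_testBit
  intro i hi
  simp only [packPhi, testBit_pkgo]
  have : ¬ i / 4 < 11 := by omega
  simp [this]

end Triangle12

end Summit.Ventures.DiscreteObjects.PP12
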